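import Summits.QuantumFields.BalabanUV.Beta.GAN24.StripAliasBounds
import Summits.QuantumFields.BalabanUV.Beta.GAN24.CapacitanceScalarBounds
import Summits.QuantumFields.BalabanUV.Beta.GAN24.AliasStripSymbols

/-!
# `BalabanUV.Beta.GAN24.StripAliasZero` — binder row G-an2-4 / (CONV-C), road P1-fibre, typer row **L10(i) = Y10g\*** part 4 (= item (d)
# of `GAN24/Formal/LEAVES.md` v2.7 § II.A3): THE ZERO ALIAS `m = 0`, SCALED, ON THE STRIP — `N²·L_0(p)`, `s_κ(0)(p)/N`, `S(0)(p)/N^D` are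
# `N`-UNIFORMLY controlled at a complex coarse momentum `p` with `|Re p_i| ≤ π`, `|Im p_i| ≤ η`

NOT IN PRINT; OUR PROOF ATTEMPT.  HONEST FRAMING (cell contract, verbatim): «discharging `BetaPertH` makes Bałaban's UV stability
UNCONDITIONAL — a real constructive-QFT result; it is NOT the continuum limit and NOT the Clay problem.»  HONEST DEPENDENCY (verbatim):
«continuum YM on T⁴ ⇐ BetaPertH ∧ nine spine estimates (0/9 proved); BetaPertH ⇐ (D1) ∧ (D4) ∧ CAP+tail; G-an2-4 gates asym, D1 and
NE2/3/4.»  [folklore] bookkeeping estimates; NO cited fact, NO `def … : Prop` hypothesis, NO wall binder, NO new object.  NOT summit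
progress; nothing of (CONV-C)'s K-slot is discharged here.

## Why (gan24-p1 DESIGNER'S RULING, CLAIMS l.3079 (2); typer row Y10zi consumes this)
The zero alias is NOT regular on the strip (`L_0(p) = Σ_κ 4 sin²(p_κ/2N)` vanishes on the complex null cone inside every strip), so
L10(ii) eliminates the (2D+2)-dimensional PINNED block `{Â(0), μ̂(0), φ, c}` jointly; what that needs from the zero alias is NOT `1/L_0`
but the `N`-uniform SIZES of the entire factors: `N²·L_0(p)` is `O(|Re p|² + η·|Re p|₁ + η²)` and `κ₀`-close to its real value, and the
zero-alias geometric weights `s_κ(0)(p) = G(p_κ/N, N)` stay comparable to `N` from BOTH sides on the whole strip (`|S(0)(p)| ≍ N^D`), exactly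
as leaf P1-L08's `CapacitanceScalarBounds.sq_le_gNormSq_zero` has on the real torus.

## What is proved (general `D`, `N ≥ 1`; `q := reVec p`; hypotheses `hre : ∀ i, |(p i).re| ≤ π`, `him : ∀ i, |(p i).im| ≤ η` as stated)
* §1 `kAl_zero` (`kAl N p 0 κ = p κ / N`), `kfine_reVec_zero`.
* §2 `N²·L_0`: `norm_LAl_zero_sub_lapR_le` (`‖L_0(p) − lapR(q/N)‖ ≤ (4η·Σ_κ|q_κ| + 4Dη²)/N²`, `η ≤ 1`), `norm_sq_mul_LAl_zero_sub_le`
  (the `N²`-scaled form), `norm_sq_mul_LAl_zero_le` (`‖N²·L_0(p)‖ ≤ momSq q + 4η·Σ|q_κ| + 4Dη²` via L08's `sq_mul_lapR_zero_le`), and the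
  holomorphic Taylor form `norm_sq_mul_LAl_zero_sub_sum_sq_le` (the entire identity `(e^{iw} − 1)(e^{−iw} − 1) = 2 − e^{iw} − e^{−iw}` is leaf-19's `AliasStripSymbols.sub_one_mul_sub_one_eq` BY NAME) (`‖N²·L_0(p) − Σ_κ (p κ)²‖ ≤ 2·(Σ_κ ‖p κ‖⁴·e^{‖p κ‖})/N²`, Mathlib
  `Complex.norm_exp_sub_sum_le_norm_mul_exp`).
* §3 `s_κ(0)` and every `s_κ(m)`: `norm_gs_sub_gs_re_le` (`‖G(x+iε, n) − G(x, n)‖ ≤ n·(e^{η} − 1)` for `|ε|·n ≤ η` — termwise),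
  `norm_sAl_le_exp_mul` / `norm_sMAl_le_exp_mul` (`≤ e^{η}·N`, `≤ e^{η}·M`, every `m`, `M ≤ N`), `norm_sAl_sub_sAl_ofRealVec_le`
  (`≤ N·(e^{η} − 1)`, every `m`), the REAL lower bound `two_div_pi_mul_le_norm_sAl_zero_ofRealVec` (`(2/π)·N ≤ ‖s_κ(0)(q)‖`, L08 BY NAME), the
  STRIP lower bound **`norm_sAl_zero_ge`** (`N·(2/π − (e^{η} − 1)) ≤ ‖s_κ(0)(p)‖`) and its clean form **`norm_sAl_zero_ge_three_tenths`**
  (`(3/10)·N ≤ ‖s_κ(0)(p)‖` for `η ≤ 1/4`), the flat twins, and the products `norm_SAl_zero_ge` / `norm_SbAl_zero_ge` (`((3/10)·N)^D ≤ ‖S(0)(p)‖`),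
  `norm_SAl_zero_le` (`≤ (e^{η}·N)^D`).
Unit `b2b-balaban-gan24-formalise-leaf-18` (G-an2-4 formalisation swarm), 2026-08-20.
-/

noncomputable section

open Complex Finset
open scoped BigOperators Real
open Literature.Probability.LatticeModels (TorusSite)
open Literature.MathematicalPhysics.QuantumFieldTheory
open Literature.MathematicalPhysics.QuantumFieldTheory.Balaban1983to89
open Literature.MathematicalPhysics.QuantumFieldTheory.King1986 (momSq momSq_nonneg)
open B4Strip (ofRealVec reVec)
open Summit.QuantumFields.BalabanUV.Beta.GAN24.AliasWeights (sinWt kfine norm_geomExp_le_of_im norm_cexp_I_mul_mul_nat)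
open Summit.QuantumFields.BalabanUV.Beta.GAN24.AliasWeightsSum (lapR lapR_nonneg)
open Summit.QuantumFields.BalabanUV.Beta.GAN24.AliasObjects (kAl gs sAl SAl sbAl SbAl sMAl SMAl)
open Summit.QuantumFields.BalabanUV.Beta.GAN24.ReadingWeightSums (kAl_ofRealVec)
open Summit.QuantumFields.BalabanUV.Beta.GAN24.CapacitanceScalarBounds (gNormSq sq_le_gNormSq_zero kfine_zero sq_mul_lapR_zero_le)
open Summit.QuantumFields.BalabanUV.Beta.GAN24.StripAliasBounds (kAl_eq_kfine_add kAl_re_im abs_im_div_le norm_LAl_sub_lapR_le cexp_I_mul_add)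

namespace Summit.QuantumFields.BalabanUV.Beta.GAN24.StripAliasZero

variable {D : ℕ} {N : ℕ} [NeZero N]

/-! ## §1 The zero alias -/

/-- [folklore] The fine momentum of the zero alias is `p/N`. -/
theorem kAl_zero (p : Fin D → ℂ) (κ : Fin D) : kAl N p 0 κ = p κ / (N : ℂ) := by
  simp [kAl, FibreDFT.kFine, LatticeForm.repZ]

omit [NeZero N] in
/-- [folklore] The real fine momentum of the zero alias is `Re p/N`. -/
theorem kfine_reVec_zero (p : Fin D → ℂ) (κ : Fin D) : kfine N (reVec p) 0 κ = (p κ).re / N := by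
  rw [kfine_zero]; rfl

/-! ## §2 The scaled Laplacian symbol `N²·L_0(p)` -/

section Strip

variable {p : Fin D → ℂ} {η : ℝ}

/-- [folklore] **`L_0` ON THE STRIP**: `‖L_0(p) − lapR(Re p/N)‖ ≤ (4η·Σ_κ |Re p_κ| + 4Dη²)/N²` (`|Im p_i| ≤ η ≤ 1`; `|sin y| ≤ |y|`). -/
theorem norm_LAl_zero_sub_lapR_le (him : ∀ i, |(p i).im| ≤ η) (hη : 0 ≤ η) (hη1 : η ≤ 1) :
    ‖AliasObjects.LAl N p 0 - ((lapR (kfine N (reVec p) 0) : ℝ) : ℂ)‖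
      ≤ (4 * η * ∑ κ, |(p κ).re| + 4 * D * η ^ 2) / (N : ℝ) ^ 2 := by
  have hN : (0 : ℝ) < N := by exact_mod_cast Nat.pos_of_ne_zero (NeZero.ne N)
  have h := norm_LAl_sub_lapR_le him hη1 (0 : TorusSite D N)
  have hsin : ∀ κ : Fin D, |Real.sin (kfine N (reVec p) 0 κ / 2)| ≤ |(p κ).re| / (2 * N) := by
    intro κ
    rw [kfine_reVec_zero]
    calc |Real.sin ((p κ).re / N / 2)| ≤ |(p κ).re / N / 2| := Real.abs_sin_le_abs
      _ = |(p κ).re| / (2 * N) := by rw [abs_div, abs_div, Nat.abs_cast, abs_two]; ring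
  have hsum : ∑ κ, |Real.sin (kfine N (reVec p) 0 κ / 2)| ≤ (∑ κ, |(p κ).re|) / (2 * N) := by
    rw [Finset.sum_div]; exact Finset.sum_le_sum fun κ _ => hsin κ
  calc ‖AliasObjects.LAl N p 0 - ((lapR (kfine N (reVec p) 0) : ℝ) : ℂ)‖
      ≤ 8 * (η / N) * ∑ κ, |Real.sin (kfine N (reVec p) 0 κ / 2)| + 4 * D * (η / N) ^ 2 := h
    _ ≤ 8 * (η / N) * ((∑ κ, |(p κ).re|) / (2 * N)) + 4 * D * (η / N) ^ 2 :=
        add_le_add (mul_le_mul_of_nonneg_left hsum (by positivity)) le_rfl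
    _ = (4 * η * ∑ κ, |(p κ).re| + 4 * D * η ^ 2) / (N : ℝ) ^ 2 := by field_simp; ring

/-- [folklore] The `N²`-SCALED form: `‖N²·L_0(p) − N²·lapR(Re p/N)‖ ≤ 4η·Σ_κ |Re p_κ| + 4Dη²` — `N`-FREE. -/
theorem norm_sq_mul_LAl_zero_sub_le (him : ∀ i, |(p i).im| ≤ η) (hη : 0 ≤ η) (hη1 : η ≤ 1) :
    ‖(N : ℂ) ^ 2 * AliasObjects.LAl N p 0 - (((N : ℝ) ^ 2 * lapR (kfine N (reVec p) 0) : ℝ) : ℂ)‖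
      ≤ 4 * η * ∑ κ, |(p κ).re| + 4 * D * η ^ 2 := by
  have hN : (0 : ℝ) < N := by exact_mod_cast Nat.pos_of_ne_zero (NeZero.ne N)
  have h := norm_LAl_zero_sub_lapR_le (N := N) him hη hη1
  have hfac : (N : ℂ) ^ 2 * AliasObjects.LAl N p 0 - (((N : ℝ) ^ 2 * lapR (kfine N (reVec p) 0) : ℝ) : ℂ)
      = ((N : ℂ) ^ 2) * (AliasObjects.LAl N p 0 - ((lapR (kfine N (reVec p) 0) : ℝ) : ℂ)) := by push_cast; ring
  rw [hfac, norm_mul, norm_pow, Complex.norm_natCast]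
  rw [le_div_iff₀ (by positivity)] at h
  linarith

/-- [folklore] **UPPER BOUND `‖N²·L_0(p)‖ ≤ |Re p|² + 4η·Σ_κ|Re p_κ| + 4Dη²`** (leaf P1-L08 `sq_mul_lapR_zero_le` at the real part + the strip). -/
theorem norm_sq_mul_LAl_zero_le (him : ∀ i, |(p i).im| ≤ η) (hη : 0 ≤ η) (hη1 : η ≤ 1) :
    ‖(N : ℂ) ^ 2 * AliasObjects.LAl N p 0‖ ≤ momSq (reVec p) + 4 * η * ∑ κ, |(p κ).re| + 4 * D * η ^ 2 := by
  have hN1 : 1 ≤ N := Nat.one_le_iff_ne_zero.2 (NeZero.ne N)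
  have h := norm_sq_mul_LAl_zero_sub_le (N := N) him hη hη1
  have hreal : ‖(((N : ℝ) ^ 2 * lapR (kfine N (reVec p) 0) : ℝ) : ℂ)‖ ≤ momSq (reVec p) := by
    rw [Complex.norm_real, Real.norm_eq_abs, abs_of_nonneg (mul_nonneg (sq_nonneg _) (lapR_nonneg _))]
    exact sq_mul_lapR_zero_le hN1 (reVec p)
  calc ‖(N : ℂ) ^ 2 * AliasObjects.LAl N p 0‖
      = ‖((N : ℂ) ^ 2 * AliasObjects.LAl N p 0 - (((N : ℝ) ^ 2 * lapR (kfine N (reVec p) 0) : ℝ) : ℂ))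
          + (((N : ℝ) ^ 2 * lapR (kfine N (reVec p) 0) : ℝ) : ℂ)‖ := by ring_nf
    _ ≤ ‖(N : ℂ) ^ 2 * AliasObjects.LAl N p 0 - (((N : ℝ) ^ 2 * lapR (kfine N (reVec p) 0) : ℝ) : ℂ)‖
          + ‖(((N : ℝ) ^ 2 * lapR (kfine N (reVec p) 0) : ℝ) : ℂ)‖ := norm_add_le _ _
    _ ≤ momSq (reVec p) + 4 * η * ∑ κ, |(p κ).re| + 4 * D * η ^ 2 := by linarith

end Strip

/-- [folklore] TAYLOR: `‖2 − e^{iw} − e^{−iw} − w²‖ ≤ 2‖w‖⁴·e^{‖w‖}` (two fourth-order exponential remainders, Mathlib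
`Complex.norm_exp_sub_sum_le_norm_mul_exp`). -/
theorem norm_two_sub_cexp_sub_cexp_sub_sq_le (w : ℂ) :
    ‖2 - cexp (I * w) - cexp (-(I * w)) - w ^ 2‖ ≤ 2 * ‖w‖ ^ 4 * Real.exp ‖w‖ := by
  have h1 := Complex.norm_exp_sub_sum_le_norm_mul_exp (I * w) 4
  have h2 := Complex.norm_exp_sub_sum_le_norm_mul_exp (-(I * w)) 4
  set S1 := ∑ m ∈ Finset.range 4, (I * w) ^ m / (m.factorial : ℂ) with hS1
  set S2 := ∑ m ∈ Finset.range 4, (-(I * w)) ^ m / (m.factorial : ℂ) with hS2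
  have hsum : S1 + S2 = 2 - w ^ 2 := by
    rw [hS1, hS2]
    simp only [Finset.sum_range_succ, Finset.sum_range_zero, Nat.factorial, Nat.succ_eq_add_one]
    push_cast
    have hI2 : I ^ 2 = -1 := Complex.I_sq
    linear_combination (w ^ 2) * hI2
  have hn1 : ‖I * w‖ = ‖w‖ := by rw [norm_mul, Complex.norm_I, one_mul]
  have hn2 : ‖-(I * w)‖ = ‖w‖ := by rw [norm_neg, hn1]
  rw [hn1] at h1
  rw [hn2] at h2
  have hid : 2 - cexp (I * w) - cexp (-(I * w)) - w ^ 2 = -((cexp (I * w) - S1) + (cexp (-(I * w)) - S2)) := by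
    linear_combination (-1 : ℂ) * hsum
  rw [hid, norm_neg]
  calc ‖(cexp (I * w) - S1) + (cexp (-(I * w)) - S2)‖ ≤ ‖cexp (I * w) - S1‖ + ‖cexp (-(I * w)) - S2‖ := norm_add_le _ _
    _ ≤ ‖w‖ ^ 4 * Real.exp ‖w‖ + ‖w‖ ^ 4 * Real.exp ‖w‖ := add_le_add h1 h2
    _ = 2 * ‖w‖ ^ 4 * Real.exp ‖w‖ := by ring

/-- [folklore] **HOLOMORPHIC TAYLOR FORM OF THE SCALED ZERO-ALIAS SYMBOL**: `‖N²·L_0(p) − Σ_κ (p κ)²‖ ≤ 2·(Σ_κ ‖p κ‖⁴·e^{‖p κ‖/N})/N²`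
(every complex `p`; `N`-uniformly `O(|p|⁴/N²)` on bounded sets — the entire continuation of leaf P1-L07's real Taylor bound). -/
theorem norm_sq_mul_LAl_zero_sub_sum_sq_le (p : Fin D → ℂ) :
    ‖(N : ℂ) ^ 2 * AliasObjects.LAl N p 0 - ∑ κ, p κ ^ 2‖ ≤ 2 * (∑ κ, ‖p κ‖ ^ 4 * Real.exp (‖p κ‖ / N)) / (N : ℝ) ^ 2 := by
  have hN : (0 : ℝ) < N := by exact_mod_cast Nat.pos_of_ne_zero (NeZero.ne N)
  have hNc : (N : ℂ) ≠ 0 := by exact_mod_cast (NeZero.ne N)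
  have hL : AliasObjects.LAl N p 0 = ∑ κ, (2 - cexp (I * (p κ / N)) - cexp (-(I * (p κ / N)))) := by
    simp only [AliasObjects.LAl, FibreSymbols.lapSym, FibreSymbols.dhat, FibreSymbols.dflat]
    exact Finset.sum_congr rfl fun κ _ => by rw [kAl_zero, AliasStripSymbols.sub_one_mul_sub_one_eq]
  have hdiff : (N : ℂ) ^ 2 * AliasObjects.LAl N p 0 - ∑ κ, p κ ^ 2
      = (N : ℂ) ^ 2 * ∑ κ, (2 - cexp (I * (p κ / N)) - cexp (-(I * (p κ / N))) - (p κ / N) ^ 2) := by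
    rw [hL, Finset.mul_sum, Finset.mul_sum, ← Finset.sum_sub_distrib]
    refine Finset.sum_congr rfl fun κ _ => ?_
    field_simp
  rw [hdiff, norm_mul, norm_pow, Complex.norm_natCast]
  have hnorm : ∀ κ : Fin D, ‖p κ / (N : ℂ)‖ = ‖p κ‖ / N := fun κ => by rw [norm_div, Complex.norm_natCast]
  calc (N : ℝ) ^ 2 * ‖∑ κ, (2 - cexp (I * (p κ / N)) - cexp (-(I * (p κ / N))) - (p κ / N) ^ 2)‖
      ≤ (N : ℝ) ^ 2 * ∑ κ, ‖2 - cexp (I * (p κ / N)) - cexp (-(I * (p κ / N))) - (p κ / N) ^ 2‖ :=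
        mul_le_mul_of_nonneg_left (norm_sum_le _ _) (sq_nonneg _)
    _ ≤ (N : ℝ) ^ 2 * ∑ κ, 2 * ‖p κ / (N : ℂ)‖ ^ 4 * Real.exp ‖p κ / (N : ℂ)‖ :=
        mul_le_mul_of_nonneg_left (Finset.sum_le_sum fun κ _ => norm_two_sub_cexp_sub_cexp_sub_sq_le (p κ / N)) (sq_nonneg _)
    _ = 2 * (∑ κ, ‖p κ‖ ^ 4 * Real.exp (‖p κ‖ / N)) / (N : ℝ) ^ 2 := by
        rw [eq_div_iff (by positivity), Finset.mul_sum, Finset.sum_mul, Finset.mul_sum]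
        refine Finset.sum_congr rfl fun κ _ => ?_
        rw [hnorm κ]
        field_simp

/-! ## §3 The zero-alias geometric weights `s_κ(0)(p) = G(p_κ/N, N)` stay comparable to `N` on the strip -/

/-- [folklore] TERMWISE STRIP COMPARISON of a geometric sum with its real-argument value: `‖G(x+iε, n) − G(x, n)‖ ≤ n·(e^{η} − 1)` whenever
`|ε|·n ≤ η` (each term: `‖e^{i(x+iε)t} − e^{ixt}‖ = |e^{−εt} − 1| ≤ e^{|ε|t} − 1 ≤ e^{η} − 1`). -/
theorem norm_gs_sub_gs_re_le (x ε : ℝ) (n : ℕ) {η : ℝ} (hε : |ε| * n ≤ η) :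
    ‖gs ((x : ℂ) + I * (ε : ℂ)) n - gs (x : ℂ) n‖ ≤ n * (Real.exp η - 1) := by
  unfold gs
  rw [← Finset.sum_sub_distrib]
  have hterm : ∀ t ∈ Finset.range n, ‖cexp (I * ((x : ℂ) + I * (ε : ℂ)) * t) - cexp (I * (x : ℂ) * t)‖ ≤ Real.exp η - 1 := by
    intro t ht
    have ht' : (t : ℝ) ≤ n := by exact_mod_cast (Finset.mem_range.1 ht).le
    have ht0 : (0 : ℝ) ≤ t := Nat.cast_nonneg t
    have hfac : cexp (I * ((x : ℂ) + I * (ε : ℂ)) * t) - cexp (I * (x : ℂ) * t) = cexp (I * (x : ℂ) * t) * (cexp ((-(ε * t) : ℝ) : ℂ) - 1) := by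
      rw [mul_sub, mul_one, ← Complex.exp_add]
      congr 2
      push_cast
      ring_nf
      rw [Complex.I_sq]
      ring
    rw [hfac, norm_mul, show I * (x : ℂ) * (t : ℂ) = I * ((x * t : ℝ) : ℂ) by push_cast; ring, Complex.norm_exp_I_mul_ofReal, one_mul]
    have hreal : cexp ((-(ε * t) : ℝ) : ℂ) - 1 = ((Real.exp (-(ε * t)) - 1 : ℝ) : ℂ) := by push_cast; ring
    rw [hreal, Complex.norm_real, Real.norm_eq_abs]
    -- `|e^{u} − 1| ≤ e^{|u|} − 1` and `|u| ≤ η`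
    have hu : |-(ε * t)| ≤ η := by
      rw [abs_neg, abs_mul, Nat.abs_cast]
      exact (mul_le_mul_of_nonneg_left ht' (abs_nonneg ε)).trans hε
    have key : ∀ u : ℝ, |Real.exp u - 1| ≤ Real.exp |u| - 1 := by
      intro u
      rcases le_or_gt 0 u with hu0 | hu0
      · rw [abs_of_nonneg hu0, abs_of_nonneg (by linarith [Real.add_one_le_exp u])]
      · rw [abs_of_neg hu0, abs_of_neg (by linarith [Real.exp_lt_one_iff.2 hu0 |>.le, Real.exp_lt_one_iff.2 hu0])]
        have h1 := Real.add_one_le_exp (-u)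
        have h2 : Real.exp u * Real.exp (-u) = 1 := by rw [← Real.exp_add, add_neg_cancel, Real.exp_zero]
        have h3 := Real.exp_pos u
        nlinarith
    calc |Real.exp (-(ε * t)) - 1| ≤ Real.exp |-(ε * t)| - 1 := key _
      _ ≤ Real.exp η - 1 := by linarith [Real.exp_le_exp.2 hu]
  calc ‖∑ t ∈ Finset.range n, (cexp (I * ((x : ℂ) + I * (ε : ℂ)) * t) - cexp (I * (x : ℂ) * t))‖
      ≤ ∑ t ∈ Finset.range n, ‖cexp (I * ((x : ℂ) + I * (ε : ℂ)) * t) - cexp (I * (x : ℂ) * t)‖ := norm_sum_le _ _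
    _ ≤ ∑ _t ∈ Finset.range n, (Real.exp η - 1) := Finset.sum_le_sum hterm
    _ = n * (Real.exp η - 1) := by rw [Finset.sum_const, Finset.card_range, nsmul_eq_mul]

section Strip

variable {p : Fin D → ℂ} {η : ℝ}

/-- [folklore] `‖s_κ(m)(p)‖ ≤ e^{η}·N` on the strip, every alias (leaf P1-L06 `norm_geomExp_le_of_im` BY NAME). -/
theorem norm_sAl_le_exp_mul (him : ∀ i, |(p i).im| ≤ η) (m : TorusSite D N) (κ : Fin D) : ‖sAl N p m κ‖ ≤ N * Real.exp η := by
  unfold sAl gs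
  refine norm_geomExp_le_of_im _ N ?_
  rw [(kAl_re_im p m κ).2, abs_div, Nat.abs_cast, div_mul_cancel₀ _ (by exact_mod_cast (NeZero.ne N) : (N : ℝ) ≠ 0)]
  exact him κ

/-- [folklore] `‖s_{M,κ}(m)(p)‖ ≤ e^{η}·M` on the strip, every alias, every `M ≤ N`. -/
theorem norm_sMAl_le_exp_mul (him : ∀ i, |(p i).im| ≤ η) {M : ℕ} (hMN : M ≤ N) (m : TorusSite D N) (κ : Fin D) :
    ‖sMAl N M p m κ‖ ≤ M * Real.exp η := by
  unfold sMAl gs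
  refine norm_geomExp_le_of_im _ M ?_
  rw [(kAl_re_im p m κ).2]
  have hN : (0 : ℝ) < N := by exact_mod_cast Nat.pos_of_ne_zero (NeZero.ne N)
  have hM : (M : ℝ) ≤ N := by exact_mod_cast hMN
  rw [abs_div, Nat.abs_cast]
  calc |(p κ).im| / N * M ≤ |(p κ).im| / N * N := mul_le_mul_of_nonneg_left hM (by positivity)
    _ = |(p κ).im| := div_mul_cancel₀ _ hN.ne'
    _ ≤ η := him κ

/-- [folklore] STRIP COMPARISON for every alias: `‖s_κ(m)(p) − s_κ(m)(Re p)‖ ≤ N·(e^{η} − 1)`. -/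
theorem norm_sAl_sub_sAl_ofRealVec_le (him : ∀ i, |(p i).im| ≤ η) (m : TorusSite D N) (κ : Fin D) :
    ‖sAl N p m κ - sAl N (ofRealVec (reVec p)) m κ‖ ≤ N * (Real.exp η - 1) := by
  unfold sAl
  rw [kAl_eq_kfine_add, kAl_ofRealVec]
  refine norm_gs_sub_gs_re_le _ _ N ?_
  rw [abs_div, Nat.abs_cast, div_mul_cancel₀ _ (by exact_mod_cast (NeZero.ne N) : (N : ℝ) ≠ 0)]
  exact him κ

/-- [folklore] REAL LOWER BOUND at the zero alias (leaf P1-L08 `CapacitanceScalarBounds.sq_le_gNormSq_zero` BY NAME): `(2/π)·N ≤ ‖s_κ(0)(q)‖` for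
`|q_κ| ≤ π`. -/
theorem two_div_pi_mul_le_norm_sAl_zero_ofRealVec {q : Fin D → ℝ} (hq : ∀ i, |q i| ≤ π) (κ : Fin D) :
    2 / π * N ≤ ‖sAl N (ofRealVec q) 0 κ‖ := by
  have hN1 : 1 ≤ N := Nat.one_le_iff_ne_zero.2 (NeZero.ne N)
  have h := sq_le_gNormSq_zero hN1 (hq κ)
  have hgs : gNormSq N (q κ / N) = ‖sAl N (ofRealVec q) 0 κ‖ ^ 2 := by
    unfold gNormSq sAl gs
    rw [kAl_ofRealVec, kfine_zero]
  rw [hgs, show 4 / π ^ 2 * (N : ℝ) ^ 2 = (2 / π * N) ^ 2 by ring] at h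
  have h0 : 0 ≤ 2 / π * (N : ℝ) := by positivity
  nlinarith [norm_nonneg (sAl N (ofRealVec q) 0 κ), sq_nonneg (‖sAl N (ofRealVec q) 0 κ‖ - 2 / π * N)]

/-- [folklore] **STRIP LOWER BOUND AT THE ZERO ALIAS**: `N·(2/π − (e^{η} − 1)) ≤ ‖s_κ(0)(p)‖` for `|Re p_κ| ≤ π`, `|Im p_κ| ≤ η`. -/
theorem norm_sAl_zero_ge (hre : ∀ i, |(p i).re| ≤ π) (him : ∀ i, |(p i).im| ≤ η) (κ : Fin D) :
    (N : ℝ) * (2 / π - (Real.exp η - 1)) ≤ ‖sAl N p 0 κ‖ := by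
  have h1 := two_div_pi_mul_le_norm_sAl_zero_ofRealVec (N := N) (q := reVec p) (fun i => hre i) κ
  have h2 := norm_sAl_sub_sAl_ofRealVec_le him (0 : TorusSite D N) κ
  have h3 := norm_sub_norm_le (sAl N (ofRealVec (reVec p)) 0 κ) (sAl N p 0 κ)
  rw [norm_sub_rev] at h2
  nlinarith

/-- [folklore] `2/π − (e^{η} − 1) ≥ 3/10` for `0 ≤ η ≤ 1/4` (`e^{1/4} ≤ 1 + 1/4 + 1/16`, `π ≤ 3.15`). -/
theorem three_tenths_le_const {η : ℝ} (hη : 0 ≤ η) (hη4 : η ≤ 1 / 4) : 3 / 10 ≤ 2 / π - (Real.exp η - 1) := by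
  have he := Real.abs_exp_sub_one_sub_id_le (x := η) (by rw [abs_of_nonneg hη]; linarith)
  have he' := le_abs_self (Real.exp η - 1 - η)
  have hexp : Real.exp η ≤ 21 / 16 := by nlinarith
  have hpi : 2 / (3.15 : ℝ) ≤ 2 / π := div_le_div_of_nonneg_left (by norm_num) Real.pi_pos Real.pi_lt_d2.le
  have h315 : (0.634 : ℝ) ≤ 2 / 3.15 := by norm_num
  linarith

/-- [folklore] **CLEAN FORM**: `(3/10)·N ≤ ‖s_κ(0)(p)‖` on the strip `|Re p_i| ≤ π`, `|Im p_i| ≤ η ≤ 1/4` — the zero-alias box weight never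
degenerates, UNIFORMLY IN `N` (the complex null cone is harmless for the WEIGHTS; only `L_0` vanishes there). -/
theorem norm_sAl_zero_ge_three_tenths (hre : ∀ i, |(p i).re| ≤ π) (him : ∀ i, |(p i).im| ≤ η) (hη : 0 ≤ η) (hη4 : η ≤ 1 / 4)
    (κ : Fin D) : 3 / 10 * (N : ℝ) ≤ ‖sAl N p 0 κ‖ := by
  have h := norm_sAl_zero_ge (N := N) hre him κ
  have hc := three_tenths_le_const hη hη4
  have hN : (0 : ℝ) ≤ N := Nat.cast_nonneg N
  nlinarith

/-- [folklore] The flat twin is the straight weight at the REFLECTED momentum: `s♭_κ(m)(p) = s_κ(−m)(−p)` is not needed — directly,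
`s♭_κ(0)(p) = G(−p_κ/N, N)` and `−p` lies in the same strip, so the same bounds hold: `(3/10)·N ≤ ‖s♭_κ(0)(p)‖`. -/
theorem norm_sbAl_zero_ge_three_tenths (hre : ∀ i, |(p i).re| ≤ π) (him : ∀ i, |(p i).im| ≤ η) (hη : 0 ≤ η) (hη4 : η ≤ 1 / 4)
    (κ : Fin D) : 3 / 10 * (N : ℝ) ≤ ‖sbAl N p 0 κ‖ := by
  have hneg : sbAl N p 0 κ = sAl N (fun i => -p i) 0 κ := by
    unfold sbAl sAl
    rw [kAl_zero, kAl_zero]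
    ring_nf
  rw [hneg]
  exact norm_sAl_zero_ge_three_tenths (p := fun i => -p i) (fun i => by rw [Complex.neg_re, abs_neg]; exact hre i)
    (fun i => by rw [Complex.neg_im, abs_neg]; exact him i) hη hη4 κ

/-- [folklore] `‖s♭_κ(m)(p)‖ ≤ e^{η}·N` on the strip, every alias. -/
theorem norm_sbAl_le_exp_mul (him : ∀ i, |(p i).im| ≤ η) (m : TorusSite D N) (κ : Fin D) : ‖sbAl N p m κ‖ ≤ N * Real.exp η := by
  unfold sbAl gs
  refine norm_geomExp_le_of_im _ N ?_
  rw [Complex.neg_im, abs_neg, (kAl_re_im p m κ).2, abs_div, Nat.abs_cast,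
    div_mul_cancel₀ _ (by exact_mod_cast (NeZero.ne N) : (N : ℝ) ≠ 0)]
  exact him κ

/-- [folklore] **THE ZERO-ALIAS BOX FACTOR FROM BELOW**: `((3/10)·N)^D ≤ ‖S(0)(p)‖` on the strip (`η ≤ 1/4`). -/
theorem norm_SAl_zero_ge (hre : ∀ i, |(p i).re| ≤ π) (him : ∀ i, |(p i).im| ≤ η) (hη : 0 ≤ η) (hη4 : η ≤ 1 / 4) :
    (3 / 10 * (N : ℝ)) ^ D ≤ ‖SAl N p 0‖ := by
  unfold SAl
  rw [norm_prod, show (3 / 10 * (N : ℝ)) ^ D = ∏ _i : Fin D, 3 / 10 * (N : ℝ) by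
    rw [Finset.prod_const, Finset.card_univ, Fintype.card_fin]]
  exact Finset.prod_le_prod (fun i _ => by positivity) fun i _ => norm_sAl_zero_ge_three_tenths hre him hη hη4 i

/-- [folklore] `((3/10)·N)^D ≤ ‖S♭(0)(p)‖` on the strip (`η ≤ 1/4`). -/
theorem norm_SbAl_zero_ge (hre : ∀ i, |(p i).re| ≤ π) (him : ∀ i, |(p i).im| ≤ η) (hη : 0 ≤ η) (hη4 : η ≤ 1 / 4) :
    (3 / 10 * (N : ℝ)) ^ D ≤ ‖SbAl N p 0‖ := by
  unfold SbAl
  rw [norm_prod, show (3 / 10 * (N : ℝ)) ^ D = ∏ _i : Fin D, 3 / 10 * (N : ℝ) by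
    rw [Finset.prod_const, Finset.card_univ, Fintype.card_fin]]
  exact Finset.prod_le_prod (fun i _ => by positivity) fun i _ => norm_sbAl_zero_ge_three_tenths hre him hη hη4 i

/-- [folklore] `‖S(m)(p)‖ ≤ (e^{η}·N)^D` on the strip, every alias. -/
theorem norm_SAl_le (him : ∀ i, |(p i).im| ≤ η) (m : TorusSite D N) : ‖SAl N p m‖ ≤ ((N : ℝ) * Real.exp η) ^ D := by
  unfold SAl
  rw [norm_prod, show ((N : ℝ) * Real.exp η) ^ D = ∏ _i : Fin D, (N : ℝ) * Real.exp η by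
    rw [Finset.prod_const, Finset.card_univ, Fintype.card_fin]]
  exact Finset.prod_le_prod (fun i _ => norm_nonneg _) fun i _ => norm_sAl_le_exp_mul him m i

/-- [folklore] `‖S♭(m)(p)‖ ≤ (e^{η}·N)^D` on the strip, every alias. -/
theorem norm_SbAl_le (him : ∀ i, |(p i).im| ≤ η) (m : TorusSite D N) : ‖SbAl N p m‖ ≤ ((N : ℝ) * Real.exp η) ^ D := by
  unfold SbAl
  rw [norm_prod, show ((N : ℝ) * Real.exp η) ^ D = ∏ _i : Fin D, (N : ℝ) * Real.exp η by
    rw [Finset.prod_const, Finset.card_univ, Fintype.card_fin]]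
  exact Finset.prod_le_prod (fun i _ => norm_nonneg _) fun i _ => norm_sbAl_le_exp_mul him m i

end Strip

end Summit.QuantumFields.BalabanUV.Beta.GAN24.StripAliasZero

end
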